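import Literature.AlgebraicGeometry.AbelianSchemes.PoincarePointOfTrivialPullback
import HarnessLib

/-!
# The Poincaré family is trivial over the unit point, and a `T`-point of `Â` restricting to the unit on a sub-object `T₀ ↠ T`
# over which `𝒫` acquires a generating section IS the unit point ([MumfordAV1970] §13, proof of the Theorem, pp. 127–129)

Layer `Literature/AlgebraicGeometry/AbelianSchemes`, namespace `Literature.AlgebraicGeometry.AbelianSchemes.AbelianSchemeOver`.  THEOREMS ONLY
(no definition, no named fact, no instance, no notation, no `sorry`).  Cell `hodgecm-mathlib` (D-0151), brick (c-geom-2a) of the «H1-DIM-ANY-CHAR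
cut» (B-p04 memo v3 §1–§2), sequel of ★ (c-geom-1) `PoincarePointOfTrivialPullback`: the point `e` of ★ `eq_of_isUnit_pullback_section_poincare` is
instantiated at the UNIT `T`-point `1 : T ⟶ Â` (the «constant point at `0̂`»), over which `𝒫` is trivial by the socket `(1 × π)^*𝒫 ≅ Λ(L)` and the
rigidification of `L` ([MumfordAV1970] §13 p. 125 «`P|_{X × {0̂}}` is trivial»).

Standing data as in ★ `PoincareFamilyPointsInjective` §3 (`S` locally Noetherian; `A, Â`; `π` flat surjective homomorphism with kernel clause `hker`;
`hL`, `hε`; `𝒫 = P` with `hsock`).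

* §1 **`nonempty_pullback_whiskerLeft_one_poincare_iso_unitModule`** — `(1_A × 1)^*𝒫 ≅ 𝒪` on `A ×_S T` for EVERY `T : Over S` (`1 : T ⟶ Â` the unit
  point): `1 = 1_A ≫ π` (★ `MonObj.one_comp`), `(1 × 1_A)^*Λ(L)` has class `1` (★ `mumfordClass_pullback_whiskerLeft_one`, rigidification), rank-one
  modules with trivial class are trivial (★ `nonempty_iso_unitModule_of_detClass_eq_one`).  `nonempty_pullback_pullback_poincare_iso_unitModule_of_comp_eq_one`
  — hence `(1 × j)^*(1 × g)^*𝒫 ≅ 𝒪` on `A ×_S T₀` whenever `j ≫ g = 1`.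
* §2 **`eq_one_of_isUnit_pullback_section_poincare`** — `𝒫` of rank one, `j : T₀ ⟶ T` with `j.left` SURJECTIVE, `g : T ⟶ Â`; if some global section
  `σ` of `(1 × g)^*𝒫` becomes a UNIT under some trivialisation of `(1 × j)^*(1 × g)^*𝒫`, then `g = 1` (★ (c-geom-1) with `e := 1`).
  `eq_one_of_exists_isUnit_pullback_section_poincare` — the same with the trivialisation existentially quantified away when `j ≫ g = 1`: if the
  «restriction» `σ ↦ ψ(η σ)` hits a unit for EVERY trivialisation `ψ`, in particular if it is SURJECTIVE onto `Γ(A ×_S T₀, 𝒪)`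
  (`eq_one_of_forall_surjective_pullback_section_poincare`), then `g = 1`.  Consumer ((c-geom-2b)): `T = Spec (R⁄J)` ⊇ `T₀ = Spec κ(0̂)`,
  `g` the canonical point — «sections over the thickening restrict ONTO `Γ(A, 𝒪_A) = κ` only if `J = 𝔪`».

HC_CM is proved only modulo the 7 printed citations until rung 0 closes; nothing here bears on a summit statement (count-neutral capital).

## References
* [MumfordAV1970] D. Mumford, *Abelian Varieties* (1970), §13, the Theorem (p. 125) and its proof (pp. 125–130).
* [MumfordFogartyKirwan1994] D. Mumford, J. Fogarty, F. Kirwan, *GIT*, 3rd ed. (1994), Ch. 6 §2 Def. 6.2 (p. 120), App. 7B (p. 240).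
* [Hartshorne1977] R. Hartshorne, *Algebraic Geometry* (1977), III Ex. 4.5 (`Pic X ≅ Ȟ¹(X, 𝒪_X^×)`).
-/

set_option autoImplicit false

noncomputable section

-- `(A.X ⊗ T).left = pullback A.X.hom T.hom` and friends hold by `rfl` only.
set_option backward.isDefEq.respectTransparency false

open CategoryTheory CategoryTheory.Limits AlgebraicGeometry MonoidalCategory CartesianMonoidalCategory

open scoped MonObj

namespace Literature.AlgebraicGeometry.AbelianSchemes

namespace AbelianSchemeOver

open Literature.AlgebraicGeometry.Motives Literature.AlgebraicGeometry.Modules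

section UnitPoint

variable {S : Scheme.{0}} [IsLocallyNoetherian S] (A hat : AbelianSchemeOver S) (π : A.X ⟶ hat.X) [IsMonHom π]
  [Flat π.left] [Surjective π.left]
  {L : A.left.Modules} (hL : HasRank L 1)
  (hε : CechPic.pullback A.unitSection (detClass (HasRank.isFiniteLocallyFree' hL)) = 1)
  (hker : ∀ (T : Over S) (u : T ⟶ A.X), u ≫ π = 1 ↔ A.MemKOfL L u)
  (P : (A.prodLeft hat).Modules)
  (hsock : Nonempty ((Scheme.Modules.pullback (A.X ◁ π).left).obj P ≅ A.mumfordBundle L))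

/-! ## §1 `𝒫` is trivial over the unit point -/

omit [IsLocallyNoetherian S] [Flat π.left] [Surjective π.left] in
/-- `(1_A × 1_Â)^*𝒫 ≅ (1_A × 1_A)^*Λ(L)`: the unit point of `Â` is `1_A ≫ π` and `(1 × π)^*𝒫 ≅ Λ(L)`. [cite: MumfordAV1970, §13, the Theorem (p. 125)] -/
theorem nonempty_pullback_whiskerLeft_one_poincare_iso_pullback_mumfordBundle (hsock' : Nonempty ((Scheme.Modules.pullback (A.X ◁ π).left).obj P ≅
      A.mumfordBundle L)) (T : Over S) :
    Nonempty ((Scheme.Modules.pullback (A.X ◁ (1 : T ⟶ hat.X)).left).obj P ≅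
      (Scheme.Modules.pullback (A.X ◁ (1 : T ⟶ A.X)).left).obj (A.mumfordBundle L)) := by
  have h1 : (1 : T ⟶ hat.X) = (1 : T ⟶ A.X) ≫ π := (MonObj.one_comp π).symm
  have hcomp : (A.X ◁ (1 : T ⟶ hat.X)).left = (A.X ◁ (1 : T ⟶ A.X)).left ≫ (A.X ◁ π).left := by
    rw [h1, MonoidalCategory.whiskerLeft_comp, Over.comp_left]
  exact ⟨(Scheme.Modules.pullbackCongr hcomp).app P ≪≫
    ((Scheme.Modules.pullbackComp (A.X ◁ (1 : T ⟶ A.X)).left (A.X ◁ π).left).app P).symm ≪≫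
    (Scheme.Modules.pullback (A.X ◁ (1 : T ⟶ A.X)).left).mapIso hsock'.some⟩

include hε hsock in
omit [IsLocallyNoetherian S] [Flat π.left] [Surjective π.left] in
/-- **`𝒫` IS TRIVIAL OVER THE UNIT POINT: `(1_A × 1)^*𝒫 ≅ 𝒪` on `A ×_S T`, for every `T : Over S`** ([MumfordAV1970] §13 p. 125 «`P|_{X × {0̂}}` is
trivial»): `1 = 1_A ≫ π`, `(1 × 1_A)^*Λ(L)` has trivial class by the rigidification of `L` (★ `mumfordClass_pullback_whiskerLeft_one`), and a rank-one
module with trivial class is trivial (★ `nonempty_iso_unitModule_of_detClass_eq_one`).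
[cite: MumfordAV1970, §13, the Theorem (p. 125)] [cite: MumfordFogartyKirwan1994, App. 7B (p. 240)] [cite: Hartshorne1977, III Ex. 4.5] -/
theorem nonempty_pullback_whiskerLeft_one_poincare_iso_unitModule (T : Over S) :
    Nonempty ((Scheme.Modules.pullback (A.X ◁ (1 : T ⟶ hat.X)).left).obj P ≅ unitModule (A.X ⊗ T).left) := by
  obtain ⟨e₁⟩ := A.nonempty_pullback_whiskerLeft_one_poincare_iso_pullback_mumfordBundle hat π P hsock T
  have hΛ : IsFiniteLocallyFree (A.mumfordBundle L) := HasRank.isFiniteLocallyFree' (A.hasRank_mumfordBundle hL)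
  have hM1 : HasRank ((Scheme.Modules.pullback (A.X ◁ (1 : T ⟶ A.X)).left).obj (A.mumfordBundle L)) 1 :=
    hasRank_pullback _ (A.hasRank_mumfordBundle hL)
  have hcl : detClass (hΛ.pullback (A.X ◁ (1 : T ⟶ A.X)).left) = 1 := by
    rw [detClass_pullback _ hΛ, A.detClass_mumfordBundle hL hΛ]
    exact A.mumfordClass_pullback_whiskerLeft_one hL hε
  obtain ⟨e₂⟩ := nonempty_iso_unitModule_of_detClass_eq_one hM1 (hΛ.pullback _) hcl
  exact ⟨e₁ ≪≫ e₂⟩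

include hε hsock in
omit [IsLocallyNoetherian S] [Flat π.left] [Surjective π.left] in
/-- **`(1 × j)^*(1 × g)^*𝒫 ≅ 𝒪` on `A ×_S T₀` whenever `j ≫ g = 1`** (the point `g` restricts to the unit point on `T₀`): pull-backs compose and §1 applies
on `T₀`. [cite: MumfordAV1970, §13, the Theorem (p. 125)] -/
theorem nonempty_pullback_pullback_poincare_iso_unitModule_of_comp_eq_one {T₀ T : Over S} (j : T₀ ⟶ T) (g : T ⟶ hat.X) (hj : j ≫ g = 1) :
    Nonempty ((Scheme.Modules.pullback (A.X ◁ j).left).obj ((Scheme.Modules.pullback (A.X ◁ g).left).obj P) ≅ unitModule (A.X ⊗ T₀).left) := by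
  have hcomp : (A.X ◁ j).left ≫ (A.X ◁ g).left = (A.X ◁ (1 : T₀ ⟶ hat.X)).left := by
    rw [← Over.comp_left, ← MonoidalCategory.whiskerLeft_comp, hj]
  obtain ⟨e⟩ := A.nonempty_pullback_whiskerLeft_one_poincare_iso_unitModule hat π hL hε P hsock T₀
  exact ⟨(Scheme.Modules.pullbackComp (A.X ◁ j).left (A.X ◁ g).left).app P ≪≫ (Scheme.Modules.pullbackCongr hcomp).app P ≪≫ e⟩

/-! ## §2 A point restricting to the unit point, over which `𝒫` acquires a generating section, is the unit point -/

include hε hker hsock in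
/-- **`g = 1` as soon as `(1 × g)^*𝒫` has a global section that becomes a UNIT under some trivialisation of its pull-back along a surjective
`1 × j : A ×_S T₀ → A ×_S T`** (★ (c-geom-1) `eq_of_isUnit_pullback_section_poincare` at `e := 1`, with §1 for `he`).
[cite: MumfordAV1970, §13 (proof of the Theorem, pp. 127–129)] -/
theorem eq_one_of_isUnit_pullback_section_poincare (hP1 : HasRank P 1) {T₀ T : Over S} (j : T₀ ⟶ T) [Surjective j.left] (g : T ⟶ hat.X)
    (σ : Γ((Scheme.Modules.pullback (A.X ◁ g).left).obj P, ⊤))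
    (φ₀ : (Scheme.Modules.pullback (A.X ◁ j).left).obj ((Scheme.Modules.pullback (A.X ◁ g).left).obj P) ≅ unitModule (A.X ⊗ T₀).left)
    (hu : IsUnit (M := Γ((A.X ⊗ T₀).left, ⊤))
      (φ₀.hom.app ⊤ (Literature.AlgebraicGeometry.Modules.unitSection (A.X ◁ j).left ((Scheme.Modules.pullback (A.X ◁ g).left).obj P) ⊤ σ))) :
    g = 1 :=
  A.eq_of_isUnit_pullback_section_poincare hat π hL hε hker P hsock hP1 j g 1
    (A.nonempty_pullback_whiskerLeft_one_poincare_iso_unitModule hat π hL hε P hsock T) σ φ₀ hu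

include hε hker hsock in
/-- **`g = 1` as soon as, for EVERY trivialisation `ψ` of `(1 × j)^*(1 × g)^*𝒫` (there is one when `j ≫ g = 1`, §1), some global section of
`(1 × g)^*𝒫` is carried by `σ ↦ ψ(η σ)` to a unit of `Γ(A ×_S T₀, 𝒪)`** — the trivialisation-free form of §2 for a point restricting to the unit on `T₀`.
[cite: MumfordAV1970, §13 (proof of the Theorem, pp. 127–129)] -/
theorem eq_one_of_exists_isUnit_pullback_section_poincare (hP1 : HasRank P 1) {T₀ T : Over S} (j : T₀ ⟶ T) [Surjective j.left] (g : T ⟶ hat.X)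
    (hj : j ≫ g = 1)
    (h : ∀ ψ : (Scheme.Modules.pullback (A.X ◁ j).left).obj ((Scheme.Modules.pullback (A.X ◁ g).left).obj P) ≅ unitModule (A.X ⊗ T₀).left,
      ∃ σ : Γ((Scheme.Modules.pullback (A.X ◁ g).left).obj P, ⊤), IsUnit (M := Γ((A.X ⊗ T₀).left, ⊤))
        (ψ.hom.app ⊤ (Literature.AlgebraicGeometry.Modules.unitSection (A.X ◁ j).left ((Scheme.Modules.pullback (A.X ◁ g).left).obj P) ⊤ σ))) :
    g = 1 := by
  obtain ⟨ψ⟩ := A.nonempty_pullback_pullback_poincare_iso_unitModule_of_comp_eq_one hat π hL hε P hsock j g hj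
  obtain ⟨σ, hu⟩ := h ψ
  exact A.eq_one_of_isUnit_pullback_section_poincare hat π hL hε hker P hsock hP1 j g σ ψ hu

include hε hker hsock in
/-- **SECTIONS OF `(1 × g)^*𝒫` RESTRICT ONTO `Γ(A ×_S T₀, 𝒪)` ONLY IF `g = 1`**: if `j ≫ g = 1`, `j.left` is surjective and for every trivialisation `ψ` of
`(1 × j)^*(1 × g)^*𝒫` the «restriction» `σ ↦ ψ(η σ) : Γ(A ×_S T, (1 × g)^*𝒫) → Γ(A ×_S T₀, 𝒪)` is SURJECTIVE, then `g = 1` (the unit `1` is hit).  This is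
[MumfordAV1970] §13 pp. 127–129 «a lift of the generating section of `P|_{X × 0̂}` to `X × Spec(R⁄J)` forces the point to be constant».
[cite: MumfordAV1970, §13 (proof of the Theorem, pp. 127–129)] -/
theorem eq_one_of_forall_surjective_pullback_section_poincare (hP1 : HasRank P 1) {T₀ T : Over S} (j : T₀ ⟶ T) [Surjective j.left]
    (g : T ⟶ hat.X) (hj : j ≫ g = 1)
    (h : ∀ ψ : (Scheme.Modules.pullback (A.X ◁ j).left).obj ((Scheme.Modules.pullback (A.X ◁ g).left).obj P) ≅ unitModule (A.X ⊗ T₀).left,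
      Function.Surjective fun σ : Γ((Scheme.Modules.pullback (A.X ◁ g).left).obj P, ⊤) =>
        ψ.hom.app ⊤ (Literature.AlgebraicGeometry.Modules.unitSection (A.X ◁ j).left ((Scheme.Modules.pullback (A.X ◁ g).left).obj P) ⊤ σ)) :
    g = 1 := by
  refine A.eq_one_of_exists_isUnit_pullback_section_poincare hat π hL hε hker P hsock hP1 j g hj fun ψ => ?_
  obtain ⟨σ, hσ⟩ := h ψ (1 : Γ((A.X ⊗ T₀).left, ⊤))
  refine ⟨σ, ?_⟩
  dsimp only at hσ
  rw [hσ]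
  exact isUnit_one

end UnitPoint

end AbelianSchemeOver

end Literature.AlgebraicGeometry.AbelianSchemes

end
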